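import Summits.QuantumFields.YangMills.Theorems.ColdStartUniversalityLatticeLangevinGreenKuboLemma
import Summits.QuantumFields.YangMills.Theorems.ColdStartUniversalityLatticeLangevinTimeDecorrelation
import Summits.QuantumFields.YangMills.Theorems.ColdStartUniversalityLatticeLangevinFellerJoint
import HarnessLib

/-!
# Route `ColdStartUniversality` (fixed-cut-off SZZ dynamics): ★★★ THE CONDITIONAL GREEN–KUBO FORMULA — the second moment of a BLOCK integral
# `∫_(s,s+b] Ĝ(U_r) dr` GIVEN THE PAST `𝓕^W_s` is `2b·GK + O(1)`, uniformly in the block position, the start and the conditioning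

Helper file (seat `ym-line-csu-p1`, g34; `--supports stmt-QuantumFields-24809`).  File 67 proved the Green–Kubo asymptotics
`|E[(∫_(0,T] Ĝ(U_r)dr)²] − 2T·GK| ≤ K` from every deterministic start (`Ĝ = G − μ_(β')G`, `GK = ∫₀^∞ ⟨Ĝ, κ_tĜ⟩_μ dt`).  For the analysis of
BATCH MEANS one needs the same statement for a block `(s, s+b]` in the middle of the run, conditionally on the past: for every bounded
`𝓕^W_s`-measurable weight `0 ≤ Z ≤ C_Z`,

  `|E[Z · (∫_(s,s+b] Ĝ(U_r) dr)²] − 2b·GK·E[Z]| ≤ K·C_Z`     (★★★ `abs_integral_mul_sq_blockIntegral_sub_le`),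

with `K = 264·C/c²` from the Harris pair `(C, c)` of the kernel mixing (`abs_transition_sub_wilson_le_exp`).  Proof: under the tilted probability
`Q = (E Z)⁻¹ Z·P` the field `g_r = Ĝ(U_(s+r))` satisfies the hypotheses of the generic Green–Kubo lemma of file 66
(`abs_integral_sq_setIntegral_sub_le_of_twoTime`): the weighted two-time products are computed by TWO applications of the Markov property of
file 44 (`E[Z Ĝ(U_(s+r))Ĝ(U_(s+r'))] = E[Z·κ_r(Ĝ·κ_(r'−r)Ĝ)(U_s)]`) and controlled by the every-start mixing of the kernels, with constants
proportional to `C_Z/E Z`; the lemma's bound is linear in these constants, so multiplying back by `E Z` gives the display.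
THEOREMS ONLY, no definition, no sorry; [folklore].  HONEST FRAMING: fixed cut-off; `C, c` depend on `L, β'`; `UniformColdStartMixing` (24809) is
NOT restated; no crux, rung or summit statement is proved; the Yang–Mills mass gap is NOT proved.
-/

set_option autoImplicit false

noncomputable section

namespace Summit.QuantumFields.YangMills.Theorems.ColdStartUniversality

open MeasureTheory ProbabilityTheory Filter Topology Set
open scoped NNReal ENNReal BigOperators
open Literature Literature.Probability.Process Literature.MathematicalPhysics.QuantumFieldTheory
open Literature.MathematicalPhysics.QuantumLattice (fundamentalRep fundamentalLatticeRep continuous_fundamentalRep)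

variable {L : ℕ} [NeZero L]

/-- ★★★ **Conditional Green–Kubo formula for block integrals** (every coupling; `K` depends on `L, β'`): there is `K ≥ 0` such that for every
realising kernel family `κ`, every jointly measurable strong solution `U` of the SU(2) SZZ dynamics from a deterministic start on ANY probability space,
every continuous `G` with `|G| ≤ 1`, every `s : ℝ≥0`, `b ≥ 0`, and every `𝓕^W_s`-measurable weight `Z` with `0 ≤ Z ≤ C_Z`:
`|E[Z·(∫_(s,s+b] (G(U_r) − μ_(β')G) dr)²] − 2b·GK·E[Z]| ≤ K·C_Z`, `GK = ∫₀^∞ ∫ Ĝ·κ_tĜ dμ_(β') dt`. [folklore] -/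
theorem abs_integral_mul_sq_blockIntegral_sub_le (L : ℕ) [NeZero L] (β' : ℝ) :
    ∃ K : ℝ, 0 ≤ K ∧
      ∀ (κ : ℝ≥0 → Kernel (GaugeConfig 3 L (Matrix.specialUnitaryGroup (Fin 2) ℂ))
          (GaugeConfig 3 L (Matrix.specialUnitaryGroup (Fin 2) ℂ))) [∀ t, IsMarkovKernel (κ t)],
        (∀ (t : ℝ≥0) (x : GaugeConfig 3 L (Matrix.specialUnitaryGroup (Fin 2) ℂ))
          (Ω : Type) [MeasurableSpace Ω] (P : Measure Ω) [IsProbabilityMeasure P]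
          (W : ℝ≥0 → Ω → (Edge 3 L × NoiseIdx 2 → ℝ)) (hW : IsFlatBrownian W P)
          (U : ℝ≥0 → Ω → GaugeConfig 3 L (Matrix.specialUnitaryGroup (Fin 2) ℂ)),
          (∀ ω, U 0 ω = x) →
          (latticeLangevinDynamics (fundamentalLatticeRep 2) β').IsSolution (fundamentalRep (Fin 2))
            hW.natFiltration P W U →
          κ t x = P.map (U t)) →
        ∀ (x : GaugeConfig 3 L (Matrix.specialUnitaryGroup (Fin 2) ℂ))
          (Ω : Type) [MeasurableSpace Ω] (P : Measure Ω) [IsProbabilityMeasure P]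
          (W : ℝ≥0 → Ω → (Edge 3 L × NoiseIdx 2 → ℝ)) (hW : IsFlatBrownian W P)
          (U : ℝ≥0 → Ω → GaugeConfig 3 L (Matrix.specialUnitaryGroup (Fin 2) ℂ)),
          (∀ ω, U 0 ω = x) →
          (latticeLangevinDynamics (fundamentalLatticeRep 2) β').IsSolution (fundamentalRep (Fin 2)) hW.natFiltration P W U →
          Measurable (Function.uncurry U) →
        ∀ (G : GaugeConfig 3 L (Matrix.specialUnitaryGroup (Fin 2) ℂ) → ℝ), Continuous G → (∀ z, |G z| ≤ 1) →
        ∀ (s : ℝ≥0) (b : ℝ), 0 ≤ b →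
        ∀ (Z : Ω → ℝ), Measurable[hW.natFiltration s] Z → (∀ ω, 0 ≤ Z ω) → ∀ (CZ : ℝ), (∀ ω, Z ω ≤ CZ) →
          |(∫ ω, Z ω * (∫ r in Ioc (s : ℝ) (s + b), (G (U r.toNNReal ω) - ∫ z, G z ∂(wilsonMeasure (d := 3) (L := L) (fundamentalRep (Fin 2)) β'))) ^ 2 ∂P) -
              2 * b * (∫ t in Ioi (0 : ℝ), (∫ y, (G y - ∫ z, G z ∂(wilsonMeasure (d := 3) (L := L) (fundamentalRep (Fin 2)) β')) *
                (∫ z, (G z - ∫ z', G z' ∂(wilsonMeasure (d := 3) (L := L) (fundamentalRep (Fin 2)) β')) ∂(κ t.toNNReal y))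
                ∂(wilsonMeasure (d := 3) (L := L) (fundamentalRep (Fin 2)) β'))) * (∫ ω, Z ω ∂P)| ≤ K * CZ := by
  classical
  haveI := secondCountableTopology_su2
  haveI := borelSpace_config L
  obtain ⟨C, c, hC, hc, hmix⟩ := abs_transition_sub_wilson_le_exp L β'
  refine ⟨(32 * (4 * C) + 68 * (2 * C)) / c ^ 2, by positivity,
    fun κ _ hreal x Ω _ P _ W hW U hU0 hU hUj G hGc hG1 s b hb Z hZF hZ0 CZ hZb => ?_⟩
  set μ : Measure (GaugeConfig 3 L (Matrix.specialUnitaryGroup (Fin 2) ℂ)) :=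
    wilsonMeasure (d := 3) (L := L) (fundamentalRep (Fin 2)) β' with hμ
  haveI : IsProbabilityMeasure μ :=
    isProbabilityMeasure_wilsonMeasure (d := 3) (L := L) (fundamentalRep (Fin 2)) (continuous_fundamentalRep (Fin 2)) β'
  have hG : Measurable G := hGc.measurable
  set m : ℝ := ∫ z, G z ∂μ with hm
  have hm1 : |m| ≤ 1 := by
    have hh := norm_integral_le_of_norm_le_const (μ := μ) (f := G) (C := 1)
      (Eventually.of_forall fun z => by simpa [Real.norm_eq_abs] using hG1 z)
    simpa [Real.norm_eq_abs] using hh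
  set Gh : GaugeConfig 3 L (Matrix.specialUnitaryGroup (Fin 2) ℂ) → ℝ := fun z => G z - m with hGh
  have hGhc : Continuous Gh := hGc.sub continuous_const
  have hGhm : Measurable Gh := hGhc.measurable
  have hGhb : ∀ z, |Gh z| ≤ 2 := fun z => by
    show |G z - m| ≤ 2
    have := abs_sub (G z) m
    linarith [hG1 z]
  -- the kernel action of `Ĝ` and its mixing (`κ_t Ĝ = κ_t G − m`)
  have hκm : ∀ t : ℝ≥0, Measurable fun y => ∫ z, Gh z ∂(κ t y) := fun t =>
    (hGhm.stronglyMeasurable.integral_kernel (κ := κ t)).measurable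
  have hGi : ∀ (ν : Measure (GaugeConfig 3 L (Matrix.specialUnitaryGroup (Fin 2) ℂ))) [IsProbabilityMeasure ν], Integrable G ν := fun ν _ =>
    (integrable_const (1 : ℝ)).mono' hG.aestronglyMeasurable (Eventually.of_forall fun z => by simpa [Real.norm_eq_abs] using hG1 z)
  have hκeq : ∀ (t : ℝ≥0) y, ∫ z, Gh z ∂(κ t y) = (∫ z, G z ∂(κ t y)) - m := fun t y => by
    simp only [hGh]
    rw [integral_sub (hGi _) (integrable_const m), integral_const, smul_eq_mul, probReal_univ, one_mul]
  have hκb : ∀ (t : ℝ≥0) y, |∫ z, Gh z ∂(κ t y)| ≤ C * Real.exp (-c * t) := fun t y => by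
    rw [hκeq]; exact hmix κ hreal G hG hG1 t y
  have hκb2 : ∀ (t : ℝ≥0) y, |∫ z, Gh z ∂(κ t y)| ≤ 2 := fun t y => by
    have hh := norm_integral_le_of_norm_le_const (μ := κ t y) (f := Gh) (C := 2)
      (Eventually.of_forall fun z => by simpa [Real.norm_eq_abs] using hGhb z)
    simpa [Real.norm_eq_abs] using hh
  -- basic facts on `Z`
  have hZm : Measurable Z := hZF.mono (hW.natFiltration.le s) le_rfl
  have hZabs : ∀ ω, |Z ω| ≤ CZ := fun ω => by rw [abs_of_nonneg (hZ0 ω)]; exact hZb ω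
  have hCZ : ∀ ω : Ω, 0 ≤ CZ := fun ω => (hZ0 ω).trans (hZb ω)
  have hZi : Integrable Z P := (integrable_const CZ).mono' hZm.aestronglyMeasurable
    (Eventually.of_forall fun ω => by rw [Real.norm_eq_abs]; exact hZabs ω)
  set EZ : ℝ := ∫ ω, Z ω ∂P with hEZ
  have hEZ0 : 0 ≤ EZ := integral_nonneg hZ0
  have hEZle : EZ ≤ CZ := by
    rcases isEmpty_or_nonempty Ω with hΩ | hΩ
    · have : EZ = 0 := by rw [hEZ]; exact integral_eq_zero_of_ae (Eventually.of_forall fun ω => (IsEmpty.false ω).elim)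
      rw [this]
      have h1 : (P : Measure Ω) Set.univ = 1 := measure_univ
      have h2 : (Set.univ : Set Ω) = ∅ := Set.eq_empty_of_isEmpty _
      rw [h2, measure_empty] at h1
      exact absurd h1 zero_ne_one
    · have hh := norm_integral_le_of_norm_le_const (μ := P) (f := Z) (C := CZ) (Eventually.of_forall fun ω => by
        rw [Real.norm_eq_abs]; exact hZabs ω)
      rw [Real.norm_eq_abs, probReal_univ, mul_one] at hh
      exact (le_abs_self _).trans hh
  have hmU : ∀ u : ℝ≥0, Measurable (U u) := fun u => (hU.adapted u).mono (hW.natFiltration.le u) le_rfl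
  -- the field, the autocorrelation
  set g : ℝ → Ω → ℝ := fun r ω => Gh (U (s + r.toNNReal) ω) with hg
  have hgm : Measurable (Function.uncurry g) := by
    have h1 : Measurable fun q : ℝ × Ω => U (s + q.1.toNNReal) q.2 :=
      hUj.comp (((measurable_real_toNNReal.comp measurable_fst).const_add s).prodMk measurable_snd)
    exact hGhm.comp h1
  have hgb : ∀ r ω, |g r ω| ≤ 2 := fun r ω => hGhb _
  set φ : ℝ → ℝ := fun t => ∫ y, Gh y * (∫ z, Gh z ∂(κ t.toNNReal y)) ∂μ with hφ
  have hφc : Continuous φ := by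
    refine continuous_of_dominated (bound := fun _ => (4 : ℝ)) (fun t => ((hGhm.mul (hκm _))).aestronglyMeasurable)
      (fun t => Eventually.of_forall fun y => ?_) (integrable_const _) (Eventually.of_forall fun y => ?_)
    · rw [norm_mul, Real.norm_eq_abs, Real.norm_eq_abs]
      calc |Gh y| * |∫ z, Gh z ∂(κ t.toNNReal y)| ≤ 2 * 2 := mul_le_mul (hGhb y) (hκb2 _ y) (abs_nonneg _) zero_le_two
        _ = 4 := by norm_num
    · exact continuous_const.mul ((continuous_transitionKernel_action β' κ hreal hGhc).comp
        (continuous_real_toNNReal.prodMk continuous_const))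
  have hφb0 : ∀ u, 0 ≤ u → |φ u| ≤ 2 * C * Real.exp (-c * u) := by
    intro u hu
    have hu' : ((u.toNNReal : ℝ≥0) : ℝ) = u := Real.coe_toNNReal _ hu
    calc |φ u| ≤ ∫ y, |Gh y * (∫ z, Gh z ∂(κ u.toNNReal y))| ∂μ := abs_integral_le_integral_abs
      _ ≤ ∫ _y, 2 * (C * Real.exp (-c * u)) ∂μ := by
          refine integral_mono_of_nonneg (Eventually.of_forall fun y => abs_nonneg _) (integrable_const _)
            (Eventually.of_forall fun y => ?_)
          dsimp only
          rw [abs_mul]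
          have h := hκb u.toNNReal y
          rw [hu'] at h
          exact mul_le_mul (hGhb y) h (abs_nonneg _) zero_le_two
      _ = 2 * C * Real.exp (-c * u) := by rw [integral_const, smul_eq_mul, probReal_univ]; ring
  -- the weighted two-time products through the Markov property (twice)
  have htimes : ∀ {r r' : ℝ}, 0 < r → r ≤ r' →
      s + r.toNNReal + (r' - r).toNNReal = s + r'.toNNReal ∧ (((r' - r).toNNReal : ℝ≥0) : ℝ) = r' - r ∧ ((r.toNNReal : ℝ≥0) : ℝ) = r := by
    intro r r' hr hle
    refine ⟨?_, Real.coe_toNNReal _ (sub_nonneg.2 hle), Real.coe_toNNReal _ hr.le⟩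
    rw [add_assoc, ← Real.toNNReal_add hr.le (sub_nonneg.2 hle), add_sub_cancel]
  -- step A: condition at time `s + r`
  have hstepA : ∀ {r r' : ℝ}, 0 < r → r ≤ r' →
      ∫ ω, Z ω * (g r ω * g r' ω) ∂P = ∫ ω, Z ω * (Gh (U (s + r.toNNReal) ω) * ∫ z, Gh z ∂(κ (r' - r).toNNReal (U (s + r.toNNReal) ω))) ∂P := by
    intro r r' hr hle
    obtain ⟨hst, -, -⟩ := htimes hr hle
    have hZ' : Measurable[hW.natFiltration (s + r.toNNReal)] fun ω => Z ω * Gh (U (s + r.toNNReal) ω) :=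
      (hZF.mono (hW.natFiltration.mono le_self_add) le_rfl).mul (hGhm.comp (hU.adapted _))
    have hZ'b : ∀ ω, |Z ω * Gh (U (s + r.toNNReal) ω)| ≤ CZ * 2 := fun ω => by
      rw [abs_mul]; exact mul_le_mul (hZabs ω) (hGhb _) (abs_nonneg _) (hCZ ω)
    have hM := integral_mul_comp_add_eq_integral_mul_transition β' κ hreal x hW hU0 hU (s + r.toNNReal) (r' - r).toNNReal hZ' hZ'b hGhm hGhb
    rw [hst] at hM
    have e1 : ∫ ω, Z ω * (g r ω * g r' ω) ∂P = ∫ ω, Z ω * Gh (U (s + r.toNNReal) ω) * Gh (U (s + r'.toNNReal) ω) ∂P :=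
      integral_congr_ae (ae_of_all _ fun ω => by simp only [hg]; ring)
    rw [e1, hM]
    exact integral_congr_ae (ae_of_all _ fun ω => by ring)
  -- (H2): decorrelation `|E_Z[g_r g_r']| ≤ C_Z · 2C e^(−c(r'−r))`
  have hH2 : ∀ {r r' : ℝ}, 0 < r → r ≤ r' → |∫ ω, Z ω * (g r ω * g r' ω) ∂P| ≤ CZ * (2 * C * Real.exp (-c * (r' - r))) := by
    intro r r' hr hle
    obtain ⟨-, htr, -⟩ := htimes hr hle
    rw [hstepA hr hle]
    have hpt : ∀ ω, |Z ω * (Gh (U (s + r.toNNReal) ω) * ∫ z, Gh z ∂(κ (r' - r).toNNReal (U (s + r.toNNReal) ω)))| ≤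
        CZ * (2 * C * Real.exp (-c * (r' - r))) := fun ω => by
      rw [abs_mul, abs_mul]
      have h1 := hκb (r' - r).toNNReal (U (s + r.toNNReal) ω)
      rw [htr] at h1
      exact mul_le_mul (hZabs ω) (by
        calc |Gh (U (s + r.toNNReal) ω)| * |∫ z, Gh z ∂(κ (r' - r).toNNReal (U (s + r.toNNReal) ω))| ≤ 2 * (C * Real.exp (-c * (r' - r))) :=
              mul_le_mul (hGhb _) h1 (abs_nonneg _) zero_le_two
          _ = 2 * C * Real.exp (-c * (r' - r)) := by ring) (mul_nonneg (abs_nonneg _) (abs_nonneg _)) (hCZ ω)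
    have hh := norm_integral_le_of_norm_le_const (μ := P)
      (f := fun ω => Z ω * (Gh (U (s + r.toNNReal) ω) * ∫ z, Gh z ∂(κ (r' - r).toNNReal (U (s + r.toNNReal) ω))))
      (C := CZ * (2 * C * Real.exp (-c * (r' - r)))) (Eventually.of_forall fun ω => by rw [Real.norm_eq_abs]; exact hpt ω)
    simpa [Real.norm_eq_abs] using hh
  -- (H1): stationarity `|E_Z[g_r g_r'] − φ(r'−r) E[Z]| ≤ C_Z · 4C e^(−cr)` (condition again at time `s`)
  have hH1 : ∀ {r r' : ℝ}, 0 < r → r ≤ r' → |(∫ ω, Z ω * (g r ω * g r' ω) ∂P) - φ (r' - r) * EZ| ≤ CZ * (4 * C * Real.exp (-c * r)) := by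
    intro r r' hr hle
    obtain ⟨-, htr, hrr⟩ := htimes hr hle
    rw [hstepA hr hle]
    -- the bounded observable `H = Ĝ · κ_t Ĝ`
    set H : GaugeConfig 3 L (Matrix.specialUnitaryGroup (Fin 2) ℂ) → ℝ := fun y => Gh y * ∫ z, Gh z ∂(κ (r' - r).toNNReal y) with hH
    have hHm : Measurable H := hGhm.mul (hκm _)
    have hHb : ∀ y, |H y| ≤ 4 := fun y => by
      rw [hH, abs_mul]
      calc |Gh y| * |∫ z, Gh z ∂(κ (r' - r).toNNReal y)| ≤ 2 * 2 := mul_le_mul (hGhb y) (hκb2 _ y) (abs_nonneg _) zero_le_two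
        _ = 4 := by norm_num
    have hM := integral_mul_comp_add_eq_integral_mul_transition β' κ hreal x hW hU0 hU s r.toNNReal hZF hZabs hHm hHb
    have e1 : ∫ ω, Z ω * (Gh (U (s + r.toNNReal) ω) * ∫ z, Gh z ∂(κ (r' - r).toNNReal (U (s + r.toNNReal) ω))) ∂P =
        ∫ ω, Z ω * H (U (s + r.toNNReal) ω) ∂P := rfl
    rw [e1, hM]
    -- mixing of `κ_r` applied to `H/4`
    have hH4m : Measurable fun y => H y / 4 := hHm.div_const 4
    have hH4b : ∀ y, |H y / 4| ≤ 1 := fun y => by rw [abs_div]; have := hHb y; norm_num at this ⊢; linarith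
    have hμH : φ (r' - r) = ∫ y, H y ∂μ := rfl
    have hdev : ∀ y, |(∫ z, H z ∂(κ r.toNNReal y)) - φ (r' - r)| ≤ 4 * C * Real.exp (-c * r) := fun y => by
      have h1 := hmix κ hreal (fun y => H y / 4) hH4m hH4b r.toNNReal y
      rw [hrr, integral_div, integral_div] at h1
      rw [hμH]
      have h2 : (∫ z, H z ∂(κ r.toNNReal y)) - ∫ y, H y ∂μ = 4 * ((∫ z, H z ∂(κ r.toNNReal y)) / 4 - (∫ y, H y ∂μ) / 4) := by ring
      rw [h2, abs_mul, abs_of_pos (by norm_num : (0 : ℝ) < 4)]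
      linarith
    have hκHm : Measurable fun y => ∫ z, H z ∂(κ r.toNNReal y) := (hHm.stronglyMeasurable.integral_kernel (κ := κ r.toNNReal)).measurable
    have hκHb : ∀ y, |∫ z, H z ∂(κ r.toNNReal y)| ≤ 4 := fun y => by
      have hh := norm_integral_le_of_norm_le_const (μ := κ r.toNNReal y) (f := H) (C := 4)
        (Eventually.of_forall fun z => by simpa [Real.norm_eq_abs] using hHb z)
      simpa [Real.norm_eq_abs] using hh
    have i1 : Integrable (fun ω => Z ω * ∫ z, H z ∂(κ r.toNNReal (U s ω))) P :=
      (integrable_const (CZ * 4)).mono' (hZm.mul (hκHm.comp (hmU s))).aestronglyMeasurable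
        (Eventually.of_forall fun ω => by
          rw [norm_mul, Real.norm_eq_abs, Real.norm_eq_abs]
          exact mul_le_mul (hZabs ω) (hκHb _) (abs_nonneg _) (hCZ ω))
    have hdiff : (∫ ω, Z ω * ∫ z, H z ∂(κ r.toNNReal (U s ω)) ∂P) - φ (r' - r) * EZ =
        ∫ ω, Z ω * ((∫ z, H z ∂(κ r.toNNReal (U s ω))) - φ (r' - r)) ∂P := by
      rw [hEZ, ← integral_const_mul, ← integral_sub i1 (hZi.const_mul _)]
      exact integral_congr_ae (ae_of_all _ fun ω => by ring)
    rw [hdiff]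
    have hpt : ∀ ω, |Z ω * ((∫ z, H z ∂(κ r.toNNReal (U s ω))) - φ (r' - r))| ≤ CZ * (4 * C * Real.exp (-c * r)) := fun ω => by
      rw [abs_mul]; exact mul_le_mul (hZabs ω) (hdev _) (abs_nonneg _) (hCZ ω)
    have hh := norm_integral_le_of_norm_le_const (μ := P) (f := fun ω => Z ω * ((∫ z, H z ∂(κ r.toNNReal (U s ω))) - φ (r' - r)))
      (C := CZ * (4 * C * Real.exp (-c * r))) (Eventually.of_forall fun ω => by rw [Real.norm_eq_abs]; exact hpt ω)
    simpa [Real.norm_eq_abs] using hh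
  /- ### the degenerate case `E Z = 0` -/
  have hblock : ∀ ω, (∫ r in Ioc (s : ℝ) (s + b), Gh (U r.toNNReal ω)) = ∫ r in Ioc (0 : ℝ) b, g r ω := by
    intro ω
    rw [← intervalIntegral.integral_of_le (by linarith : (s : ℝ) ≤ s + b), ← intervalIntegral.integral_of_le hb]
    have h1 := intervalIntegral.integral_comp_add_left (fun r => Gh (U r.toNNReal ω)) (s : ℝ) (a := 0) (b := b)
    rw [add_zero] at h1
    rw [← h1]
    refine intervalIntegral.integral_congr fun r hr => ?_
    have hr0 : 0 ≤ r := by rw [Set.uIcc_of_le hb] at hr; exact hr.1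
    show Gh (U ((s : ℝ) + r).toNNReal ω) = g r ω
    simp only [hg]
    rw [Real.toNNReal_add (NNReal.coe_nonneg s) hr0, Real.toNNReal_coe]
  rcases eq_or_lt_of_le hEZ0 with hEZ00 | hEZpos
  · -- `Z = 0` a.e.
    have hZae : Z =ᵐ[P] 0 := (integral_eq_zero_iff_of_nonneg (fun ω => hZ0 ω) hZi).1 hEZ00.symm
    have h0 : ∫ ω, Z ω * (∫ r in Ioc (s : ℝ) (s + b), Gh (U r.toNNReal ω)) ^ 2 ∂P = 0 := by
      refine integral_eq_zero_of_ae ?_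
      filter_upwards [hZae] with ω hω
      simp [hω]
    show |(∫ ω, Z ω * (∫ r in Ioc (s : ℝ) (s + b), Gh (U r.toNNReal ω)) ^ 2 ∂P) - 2 * b * (∫ t in Ioi (0 : ℝ), φ t) * EZ| ≤ _
    rw [h0, ← hEZ00, mul_zero, sub_zero, abs_zero]
    exact mul_nonneg (by positivity) ((hZ0 (Classical.choice (by
      by_contra hne; rw [not_nonempty_iff] at hne
      have h1 : (P : Measure Ω) Set.univ = 1 := measure_univ
      rw [Set.eq_empty_of_isEmpty (Set.univ : Set Ω), measure_empty] at h1
      exact zero_ne_one h1))).trans (hZb _))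
  /- ### the tilted probability `Q = (E Z)⁻¹ Z · P` -/
  set Q : Measure Ω := P.withDensity fun ω => ENNReal.ofReal (Z ω / EZ) with hQ
  have hdens : Measurable fun ω => ENNReal.ofReal (Z ω / EZ) := (hZm.div_const EZ).ennreal_ofReal
  have hQint : ∀ (f : Ω → ℝ), ∫ ω, f ω ∂Q = ∫ ω, (Z ω / EZ) * f ω ∂P := fun f => by
    rw [hQ, integral_withDensity_eq_integral_toReal_smul hdens (Eventually.of_forall fun _ => ENNReal.ofReal_lt_top)]
    refine integral_congr_ae (ae_of_all _ fun ω => ?_)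
    show (ENNReal.ofReal (Z ω / EZ)).toReal • f ω = Z ω / EZ * f ω
    rw [ENNReal.toReal_ofReal (div_nonneg (hZ0 ω) hEZ0), smul_eq_mul]
  haveI : IsProbabilityMeasure Q := by
    constructor
    rw [hQ, withDensity_apply _ MeasurableSet.univ, Measure.restrict_univ,
      ← ofReal_integral_eq_lintegral_ofReal (hZi.div_const EZ) (Eventually.of_forall fun ω => div_nonneg (hZ0 ω) hEZ0)]
    rw [integral_div, ← hEZ, div_self hEZpos.ne', ENNReal.ofReal_one]
  -- the hypotheses of the Green–Kubo lemma under `Q`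
  set C₁ : ℝ := CZ / EZ * (4 * C) with hC₁
  set C₂ : ℝ := CZ / EZ * (2 * C) with hC₂
  have hratio : 1 ≤ CZ / EZ := by rw [le_div_iff₀ hEZpos, one_mul]; exact hEZle
  have hQprod : ∀ r r', ∫ ω, g r ω * g r' ω ∂Q = (∫ ω, Z ω * (g r ω * g r' ω) ∂P) / EZ := fun r r' => by
    rw [hQint, ← integral_div]
    exact integral_congr_ae (ae_of_all _ fun ω => by ring)
  have h1 : ∀ r ∈ Ioc 0 b, ∀ r' ∈ Ioc 0 b, r ≤ r' → |(∫ ω, g r ω * g r' ω ∂Q) - φ (r' - r)| ≤ C₁ * Real.exp (-c * r) := by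
    intro r hr r' _ hle
    rw [hQprod]
    have hh := hH1 hr.1 hle
    have heq : (∫ ω, Z ω * (g r ω * g r' ω) ∂P) / EZ - φ (r' - r) = ((∫ ω, Z ω * (g r ω * g r' ω) ∂P) - φ (r' - r) * EZ) / EZ := by
      field_simp
    rw [heq, abs_div, abs_of_pos hEZpos, div_le_iff₀ hEZpos, hC₁]
    calc |(∫ ω, Z ω * (g r ω * g r' ω) ∂P) - φ (r' - r) * EZ| ≤ CZ * (4 * C * Real.exp (-c * r)) := hh
      _ = CZ / EZ * (4 * C) * Real.exp (-c * r) * EZ := by field_simp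
  have h2 : ∀ r ∈ Ioc 0 b, ∀ r' ∈ Ioc 0 b, r ≤ r' → |∫ ω, g r ω * g r' ω ∂Q| ≤ C₂ * Real.exp (-c * (r' - r)) := by
    intro r hr r' _ hle
    rw [hQprod, abs_div, abs_of_pos hEZpos, div_le_iff₀ hEZpos, hC₂]
    calc |∫ ω, Z ω * (g r ω * g r' ω) ∂P| ≤ CZ * (2 * C * Real.exp (-c * (r' - r))) := hH2 hr.1 hle
      _ = CZ / EZ * (2 * C) * Real.exp (-c * (r' - r)) * EZ := by field_simp
  have hφb : ∀ u, 0 ≤ u → |φ u| ≤ C₂ * Real.exp (-c * u) := fun u hu => (hφb0 u hu).trans (by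
    rw [hC₂]
    have : 2 * C ≤ CZ / EZ * (2 * C) := by nlinarith
    exact mul_le_mul_of_nonneg_right this (Real.exp_pos _).le)
  -- the Green–Kubo lemma under `Q`
  have hGK := abs_integral_sq_setIntegral_sub_le_of_twoTime (P := Q) hgm hgb hφc.measurable hb (by positivity) (by positivity) hc hφb h1 h2
  -- back to `P`
  have hQsq : ∫ ω, (∫ r in Ioc 0 b, g r ω) ^ 2 ∂Q = (∫ ω, Z ω * (∫ r in Ioc (s : ℝ) (s + b), Gh (U r.toNNReal ω)) ^ 2 ∂P) / EZ := by
    rw [hQint, ← integral_div]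
    exact integral_congr_ae (ae_of_all _ fun ω => by dsimp only; rw [hblock ω]; ring)
  rw [hQsq] at hGK
  have hfin : |(∫ ω, Z ω * (∫ r in Ioc (s : ℝ) (s + b), Gh (U r.toNNReal ω)) ^ 2 ∂P) - 2 * b * (∫ u in Ioi (0 : ℝ), φ u) * EZ| ≤
      (32 * C₁ + 68 * C₂) / c ^ 2 * EZ := by
    have heq : (∫ ω, Z ω * (∫ r in Ioc (s : ℝ) (s + b), Gh (U r.toNNReal ω)) ^ 2 ∂P) - 2 * b * (∫ u in Ioi (0 : ℝ), φ u) * EZ =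
        ((∫ ω, Z ω * (∫ r in Ioc (s : ℝ) (s + b), Gh (U r.toNNReal ω)) ^ 2 ∂P) / EZ - 2 * b * ∫ u in Ioi (0 : ℝ), φ u) * EZ := by
      field_simp
    rw [heq, abs_mul, abs_of_pos hEZpos]
    exact mul_le_mul_of_nonneg_right hGK hEZpos.le
  refine hfin.trans (le_of_eq ?_)
  rw [hC₁, hC₂]
  field_simp

end Summit.QuantumFields.YangMills.Theorems.ColdStartUniversality

end
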